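import Literature.NumberTheory.Automorphic.CuspConditionGLLieDeriv
import Literature.NumberTheory.Automorphic.CuspFormsRapidDecayUnipotentArch
import Literature.NumberTheory.Automorphic.AutomorphicRepDataSplitCenter
import Literature.NumberTheory.Automorphic.AutomorphicRepsGLCuspFormsSquareIntegrable
import Literature.NumberTheory.Automorphic.AdeleRingStrongApproximation
import HarnessLib

/-!
# A cusp form on `GL_n`, `n ≥ 2`, annihilated by the Lie derivatives along the square-zero
# directions at ONE archimedean place vanishes

Topic `NumberTheory/Automorphic`; namespace `Literature.NumberTheory.Automorphic`.  Theorems and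
one small definition (`supportedAt`); no named fact, no `sorry`.

Let `K` be a number field, `n ≥ 2`, `φ ∈ 𝒜₀ = cuspFormsGL n K hcpt` an element of the space of
cusp forms on `GL_n(𝔸_K)` (Borel–Jacquet model of the tree, `AutomorphicRepsGL`), and `σ₀` an
infinite place of `K`.  **If `X φ = 0` for every `X ∈ 𝔤𝔩_n(K_∞)` with `X² = 0` supported at the
place `σ₀`, then `φ = 0`** (`eq_zero_of_mem_cuspFormsGL_of_forall_lieDeriv_eq_zero`).  In
particular a cusp form killed by the Lie derivatives along `𝔰𝔩_n(K_{σ₀})` — e.g. a vector of a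
cuspidal automorphic representation annihilated by the six operators `L(E), L(F), L(H), R(E),
R(F), R(H)` of `GL2CUnitaryKTypes` at a complex place (`GL2CArchOps.rho_apply_eq_zero_of_killed`)
— is zero: cuspidal representations of `GL_n`, `n ≥ 2`, have no one-dimensional constituent at
any archimedean place (the hypothesis "no `SL₂(ℂ)`-invariants: cuspidality" of
`GL2CUnitaryKTypes.exists_isHW_two_mul`, [Harder1987, §3.1]).  Corollaries:
`…_of_forall_sq_eq_zero` (all square-zero `X ∈ 𝔤𝔩_n(K_∞)`), `…_complexPlace`
(`X = complexPlaceLie n w Z`, `Z ∈ M_n(ℂ)`, `Z² = 0`; this is `ComplexPlace.placeLie n w Z` of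
`ArchComplexPlaceCasimir` definitionally), `…_realPlace`.

**Proof** (the printed ingredients are the cusp condition [BorelJacquet1979, §4.4] and strong
approximation for the adele ring leaving one infinite place free [CasselsFrohlichANT1967, Ch. II
§15]; the rest is folklore).
1. `X φ = 0` for a square-zero `X` integrates to `φ (g · (exp tX)_∞) = φ g`
   (`apply_mul_expMem_eq_exp_mul_of_lieDeriv_eq_smul` with `μ = 0`).
2. For an ARCHIMEDEAN block-nilpotent `archBlock b ∈ 𝔫_k(𝔸_K)` with direction `b` supported at
   `σ₀` and any `g ∈ GL_n(𝔸_K)`: `(1 + archBlock b) g = g · (exp X', 1)` with MW's twisted direction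
   `X' = g_∞⁻¹ · blockMatrixOf b · g_∞` (`CuspFormsRapidDecayUnipotentArch`), square-zero and
   supported at `σ₀`, so `F(X) = φ ((1 + X) g)` is invariant under `X ↦ X + archBlock b`
   (`apply_unipotentOfBlock_archBlock_add_mul`).
3. `F` is invariant under the rational block-nilpotent matrices `𝔫_k(K)`
   (`IsLeftInvariant.apply_glUnipotent_vadd_mul`, left `GL_n(K)`-invariance).
4. **`K + K_{σ₀}` is dense in `𝔸_K`** (`AdeleRing.exists_principal_add_single_mem_nhds`, from
   `AdeleRing.strongApproximation_infinitePlace` and neighbourhood bases of `0` in `K_∞` and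
   `𝔸_K^∞`), hence `𝔫_k(K) + archBlock(directions supported at σ₀)` is dense in `𝔫_k(𝔸_K)`
   (`exists_rational_add_archBlock_mem_nhds`); `F` is continuous, so `F ≡ φ g`.
5. The cusp condition along `P_1` over Tate's block fundamental domain `𝓕` (positive finite Haar
   measure, `BlockUnipotentDomains`) reads `φ(g) · ν(𝓕) = 0`, so `φ g = 0`.

## References

* A. Borel, H. Jacquet, *Automorphic forms and automorphic representations*, Proc. Sympos. Pure
  Math. 33 (1979), part 1, §4.4 (cusp forms). [BorelJacquet1979]
* J. W. S. Cassels, A. Fröhlich (eds.), *Algebraic Number Theory* (1967), Ch. II §15 (strong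
  approximation theorem). [CasselsFrohlichANT1967]
* G. Harder, *Eisenstein cohomology of arithmetic groups. The case `GL₂`*, Invent. Math. 89
  (1987), §3.1 (the cuspidal `(𝔤, K)`-modules are infinite-dimensional). [Harder1987]
* C. Moeglin, J.-L. Waldspurger, *Spectral decomposition and Eisenstein series* (1995), proof of
  Lemma I.2.10 (the twisted direction `X' = Ad(g_∞⁻¹) X`). [MoeglinWaldspurger1995]
-/

-- Mathlib idiom (Mathlib/Algebra/Lie/OfAssociative.lean); needed to mention Lie subalgebras of matrix algebras
attribute [local instance 100] LieRing.ofAssociativeRing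

noncomputable section

open scoped MatrixGroups Topology RestrictedProduct Classical
open NumberField NumberField.InfinitePlace NumberField.mixedEmbedding IsDedekindDomain MeasureTheory
  Filter Set

namespace Literature.NumberTheory.Automorphic

/-! ### 1. Elements of `K_∞ = ℝ^{r₁} × ℂ^{r₂}` supported at one infinite place -/

section Support

variable (K : Type) [Field K] [NumberField K]

/-- **The ideal of `K_∞ = ℝ^{r₁} × ℂ^{r₂}` of elements supported at the infinite place `σ₀`**:
all components at the places `≠ σ₀` vanish. [folklore] -/
def supportedAt (σ₀ : InfinitePlace K) : Ideal (mixedSpace K) where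
  carrier := {x | (∀ w : {w : InfinitePlace K // w.IsReal}, w.1 ≠ σ₀ → x.1 w = 0) ∧
    (∀ w : {w : InfinitePlace K // w.IsComplex}, w.1 ≠ σ₀ → x.2 w = 0)}
  zero_mem' := ⟨fun _ _ => rfl, fun _ _ => rfl⟩
  add_mem' {x y} hx hy := ⟨fun w hw => by
      change x.1 w + y.1 w = 0
      rw [hx.1 w hw, hy.1 w hw, add_zero],
    fun w hw => by
      change x.2 w + y.2 w = 0
      rw [hx.2 w hw, hy.2 w hw, add_zero]⟩
  smul_mem' c x hx := ⟨fun w hw => by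
      change c.1 w * x.1 w = 0
      rw [hx.1 w hw, mul_zero],
    fun w hw => by
      change c.2 w * x.2 w = 0
      rw [hx.2 w hw, mul_zero]⟩

variable {K}

omit [NumberField K] in
/-- Membership in `supportedAt K σ₀` (definitional). [folklore] -/
theorem mem_supportedAt_iff {σ₀ : InfinitePlace K} {x : mixedSpace K} :
    x ∈ supportedAt K σ₀ ↔ (∀ w : {w : InfinitePlace K // w.IsReal}, w.1 ≠ σ₀ → x.1 w = 0) ∧
      (∀ w : {w : InfinitePlace K // w.IsComplex}, w.1 ≠ σ₀ → x.2 w = 0) :=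
  Iff.rfl

omit [NumberField K] in
/-- The image in `K_∞ ≅ ℝ^{r₁} × ℂ^{r₂}` of an infinite adele vanishing away from `σ₀` is supported
at `σ₀`. [folklore] -/
theorem ringEquiv_mixedSpace_mem_supportedAt {σ₀ : InfinitePlace K} {a : InfiniteAdeleRing K}
    (ha : ∀ σ : InfinitePlace K, σ ≠ σ₀ → a σ = 0) :
    InfiniteAdeleRing.ringEquiv_mixedSpace K a ∈ supportedAt K σ₀ := by
  rw [InfiniteAdeleRing.ringEquiv_mixedSpace_apply]
  exact ⟨fun w hw => by simp [ha w.1 hw], fun w hw => by simp [ha w.1 hw]⟩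

/-- Entries of a product `M Y` stay in an ideal containing the entries of `Y`. [folklore] -/
theorem Matrix.mul_apply_mem_ideal {R : Type*} [CommRing R] {m : Type*} [Fintype m]
    (I : Ideal R) (M Y : Matrix m m R) (hY : ∀ i j, Y i j ∈ I) (i j : m) : (M * Y) i j ∈ I := by
  rw [Matrix.mul_apply]
  exact I.sum_mem fun l _ => I.mul_mem_left _ (hY l j)

/-- Entries of a product `Y M` stay in an ideal containing the entries of `Y`. [folklore] -/
theorem Matrix.apply_mul_mem_ideal {R : Type*} [CommRing R] {m : Type*} [Fintype m]
    (I : Ideal R) (Y M : Matrix m m R) (hY : ∀ i j, Y i j ∈ I) (i j : m) : (Y * M) i j ∈ I := by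
  rw [Matrix.mul_apply]
  exact I.sum_mem fun l _ => I.mul_mem_right _ (hY i l)

end Support

/-! ### 2. Archimedean block unipotents supported at one place -/

section ArchBlock

variable {n k : ℕ} {K : Type} [Field K] [NumberField K]

omit [NumberField K] in
/-- The block matrix of a direction supported at `σ₀` has entries supported at `σ₀`. [folklore] -/
theorem blockMatrixOf_apply_mem_supportedAt {σ₀ : InfinitePlace K} {b : ArchBlockSpace n k K}
    (hb : ∀ p, b p ∈ supportedAt K σ₀) (i j : Fin n) : blockMatrixOf n k K b i j ∈ supportedAt K σ₀ := by
  by_cases h : (i : ℕ) < k ∧ k ≤ (j : ℕ)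
  · rw [blockMatrixOf_apply_of_mem b h]; exact hb _
  · rw [blockMatrixOf_apply_of_not b h]; exact Ideal.zero_mem _

/-- **MW's twisted direction `X' = g_∞⁻¹ · blockMatrixOf b · g_∞` stays supported at `σ₀`**
(conjugation is entrywise polynomial). [folklore] -/
theorem twistedBlockDir_apply_mem_supportedAt {σ₀ : InfinitePlace K} (g : GL (Fin n) (AdeleRing (𝓞 K) K))
    {b : ArchBlockSpace n k K} (hb : ∀ p, b p ∈ supportedAt K σ₀) (i j : Fin n) :
    twistedBlockDir n k K g b i j ∈ supportedAt K σ₀ :=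
  Matrix.apply_mul_mem_ideal _ _ _ (Matrix.mul_apply_mem_ideal _ _ _ (blockMatrixOf_apply_mem_supportedAt hb)) i j

/-- **`(1 + archBlock b) g = g · (exp X', 1)`** for the archimedean block unipotent of the direction
`b` (`inv_mul_archUnipotent_smul_mul` of `CuspFormsRapidDecayUnipotentArch` at `t = 1`).
[cite: MoeglinWaldspurger1995, proof of Lemma I.2.10] -/
theorem archUnipotent_mul_eq (g : GL (Fin n) (AdeleRing (𝓞 K) K)) (b : ArchBlockSpace n k K) :
    archUnipotent n k K b * g =
      g * glArch n K ((archGroupGL n K).expMem ((1 : ℝ) • lieOf (twistedBlockDir n k K g b))) := by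
  rw [← inv_mul_archUnipotent_smul_mul g b 1, one_smul]
  simp only [← mul_assoc, mul_inv_cancel, one_mul]

/-- **Invariance under archimedean block unipotents**: if `φ` is smooth in the archimedean
variable and `Y φ = 0` for every square-zero `Y ∈ 𝔤𝔩_n(K_∞)` supported at `σ₀`, then
`φ ((1 + archBlock b) g) = φ g` for every block direction `b` supported at `σ₀` (the twisted
direction `X'` is square-zero and supported at `σ₀`, and `φ (g exp (tX')) = e^{0·t} φ g`,
`apply_mul_expMem_eq_exp_mul_of_lieDeriv_eq_smul`). [folklore] -/
theorem apply_archUnipotent_mul {σ₀ : InfinitePlace K}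
    {φ : GL (Fin n) (AdeleRing (𝓞 K) K) → ℂ} (hφs : IsArchSmooth (glArch n K) φ)
    (h : ∀ Y : Matrix (Fin n) (Fin n) (mixedSpace K), Y * Y = 0 → (∀ i j, Y i j ∈ supportedAt K σ₀) →
      lieDeriv (glArch n K) (lieOf Y) φ = 0)
    {b : ArchBlockSpace n k K} (hb : ∀ p, b p ∈ supportedAt K σ₀) (g : GL (Fin n) (AdeleRing (𝓞 K) K)) :
    φ (archUnipotent n k K b * g) = φ g := by
  have hlie : lieDeriv (glArch n K) (lieOf (twistedBlockDir n k K g b)) φ = (0 : ℂ) • φ := by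
    rw [zero_smul]
    exact h _ (twistedBlockDir_mul_self g b) (twistedBlockDir_apply_mem_supportedAt g hb)
  have key := apply_mul_expMem_eq_exp_mul_of_lieDeriv_eq_smul (glArch n K) hφs hlie g 1
  rw [zero_mul, Complex.exp_zero, one_mul] at key
  rw [archUnipotent_mul_eq g b]
  exact key

/-- The same, inside the constant-term integrand: `φ ((1 + (archBlock b + X)) g) = φ ((1 + X) g)`.
[folklore] -/
theorem apply_unipotentOfBlock_archBlock_add_mul {σ₀ : InfinitePlace K}
    {φ : GL (Fin n) (AdeleRing (𝓞 K) K) → ℂ} (hφs : IsArchSmooth (glArch n K) φ)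
    (h : ∀ Y : Matrix (Fin n) (Fin n) (mixedSpace K), Y * Y = 0 → (∀ i j, Y i j ∈ supportedAt K σ₀) →
      lieDeriv (glArch n K) (lieOf Y) φ = 0)
    {b : ArchBlockSpace n k K} (hb : ∀ p, b p ∈ supportedAt K σ₀)
    (X : blockNilpotent n k (AdeleRing (𝓞 K) K)) (g : GL (Fin n) (AdeleRing (𝓞 K) K)) :
    φ (unipotentOfBlock n k (AdeleRing (𝓞 K) K) (Multiplicative.ofAdd (archBlock n k K b + X)) * g) =
      φ (unipotentOfBlock n k (AdeleRing (𝓞 K) K) (Multiplicative.ofAdd X) * g) := by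
  rw [ofAdd_add, map_mul, mul_assoc]
  exact apply_archUnipotent_mul hφs h hb _

end ArchBlock

/-! ### 3. `K + K_{σ₀}` is dense in `𝔸_K` -/

section Density

variable (K : Type) [Field K] [NumberField K]

/-- Every neighbourhood of `0` in `K_∞ = ∏_σ K_σ` contains a uniform ball `{a | ∀ σ, ‖a_σ‖ < ε}`.
[folklore] -/
theorem InfiniteAdeleRing.exists_forall_norm_lt_subset {V : Set (InfiniteAdeleRing K)}
    (hV : V ∈ 𝓝 (0 : InfiniteAdeleRing K)) :
    ∃ ε : ℝ, 0 < ε ∧ {a : InfiniteAdeleRing K | ∀ σ, ‖a σ‖ < ε} ⊆ V := by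
  have hV' : V ∈ Filter.pi fun σ : InfinitePlace K => 𝓝 ((0 : InfiniteAdeleRing K) σ) := by
    have e : 𝓝 (0 : InfiniteAdeleRing K) = Filter.pi fun σ : InfinitePlace K => 𝓝 ((0 : InfiniteAdeleRing K) σ) :=
      nhds_pi
    rw [← e]; exact hV
  obtain ⟨I, t, ht, hIt⟩ := Filter.mem_pi'.1 hV'
  have hball : ∀ σ : InfinitePlace K, ∃ ε : ℝ, 0 < ε ∧ Metric.ball (0 : σ.Completion) ε ⊆ t σ :=
    fun σ => Metric.mem_nhds_iff.1 (ht σ)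
  choose ε hε hεt using hball
  refine ⟨Finset.univ.inf' Finset.univ_nonempty ε, (Finset.lt_inf'_iff _).2 fun σ _ => hε σ, ?_⟩
  intro a ha
  refine hIt fun σ _ => hεt σ ?_
  rw [Metric.mem_ball, dist_zero_right]
  exact (ha σ).trans_le (Finset.inf'_le _ (Finset.mem_univ σ))

/-- Every neighbourhood of `0` in `𝔸_K^∞` contains a box `{b | ∀ v, |b_v|_v ≤ q_v^{-m_v}}` with `m`
finitely supported (the restricted product topology at the integral point `0`). [folklore] -/
theorem FiniteAdeleRing.exists_finsupp_forall_valued_le_subset {V : Set (FiniteAdeleRing (𝓞 K) K)}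
    (hV : V ∈ 𝓝 (0 : FiniteAdeleRing (𝓞 K) K)) :
    ∃ m : HeightOneSpectrum (𝓞 K) →₀ ℕ,
      {b : FiniteAdeleRing (𝓞 K) K | ∀ v, Valued.v (b v) ≤ WithZero.exp (-(m v : ℤ))} ⊆ V := by
  classical
  set b' : ∀ v : HeightOneSpectrum (𝓞 K), ↥((v.adicCompletionIntegers K : Set (v.adicCompletion K))) :=
    fun v => ⟨0, (v.adicCompletionIntegers K).zero_mem⟩ with hb'
  have hbb : (show FiniteAdeleRing (𝓞 K) K from
      RestrictedProduct.structureMap (HeightOneSpectrum.adicCompletion (R := 𝓞 K) K)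
        (fun v : HeightOneSpectrum (𝓞 K) => (v.adicCompletionIntegers K : Set (v.adicCompletion K)))
        Filter.cofinite b') = 0 :=
    FiniteAdeleRing.ext K fun v => rfl
  have hAopen : ∀ v : HeightOneSpectrum (𝓞 K),
      IsOpen (v.adicCompletionIntegers K : Set (v.adicCompletion K)) :=
    fun v => Valued.isOpen_valuationSubring _
  rw [← hbb] at hV
  have hV' : V ∈ @nhds (Πʳ v : HeightOneSpectrum (𝓞 K), [v.adicCompletion K, v.adicCompletionIntegers K])
      _ (RestrictedProduct.structureMap (HeightOneSpectrum.adicCompletion (R := 𝓞 K) K)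
      (fun v : HeightOneSpectrum (𝓞 K) => (v.adicCompletionIntegers K : Set (v.adicCompletion K)))
      Filter.cofinite b') := hV
  rw [RestrictedProduct.nhds_eq_map_structureMap hAopen] at hV'
  have h3 := Filter.mem_map.mp hV'
  rw [nhds_pi] at h3
  obtain ⟨I, t, ht, hIt⟩ := Filter.mem_pi'.mp h3
  -- valuation balls inside the `t v`
  have hball : ∀ v : HeightOneSpectrum (𝓞 K), ∃ δ : WithZero (Multiplicative ℤ), δ ≠ 0 ∧
      ∀ w : ↥((v.adicCompletionIntegers K : Set (v.adicCompletion K))),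
        Valued.v ((w : v.adicCompletion K) - b' v) < δ → w ∈ t v := by
    intro v
    obtain ⟨o, ho, hot⟩ := (mem_nhds_subtype _ _ _).mp (ht v)
    obtain ⟨γ, hγ⟩ := Valued.mem_nhds.mp ho
    refine ⟨MonoidWithZeroHom.ValueGroup₀.embedding γ.1, ?_, fun w hw => hot (hγ ?_)⟩
    · intro h0
      apply γ.ne_zero
      have : MonoidWithZeroHom.ValueGroup₀.embedding γ.1 =
          MonoidWithZeroHom.ValueGroup₀.embedding (0 : MonoidWithZeroHom.ValueGroup₀
            (.ofClass (Valued.v (R := v.adicCompletion K)))) := by rw [h0, map_zero]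
      exact MonoidWithZeroHom.ValueGroup₀.embedding_strictMono.injective this
    · change Valued.v.restrict ((w : v.adicCompletion K) - b' v) < γ.1
      rw [Valuation.restrict_lt_iff_lt_embedding]
      exact hw
  choose δ hδ0 hδ using hball
  have hN : ∀ v : HeightOneSpectrum (𝓞 K), ∃ N : ℕ, WithZero.exp (-(N : ℤ)) < δ v :=
    fun v => WithZero.exists_exp_neg_natCast_lt (hδ0 v)
  choose N hN using hN
  refine ⟨Finsupp.onFinset I (fun v => if v ∈ I then N v else 0) (fun v hv => by
    by_contra hvI; exact hv (if_neg hvI)), fun b hb => ?_⟩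
  have hint : ∀ v : HeightOneSpectrum (𝓞 K), b v ∈ v.adicCompletionIntegers K := fun v => by
    rw [HeightOneSpectrum.mem_adicCompletionIntegers]
    refine (hb v).trans ?_
    rw [← WithZero.exp_zero, WithZero.exp_le_exp]
    omega
  set z : ∀ v : HeightOneSpectrum (𝓞 K), ↥((v.adicCompletionIntegers K : Set (v.adicCompletion K))) :=
    fun v => ⟨b v, hint v⟩ with hz
  have hzt : z ∈ Set.pi (↑I) t := by
    intro v hv
    refine hδ v _ ?_
    have e : ((z v : v.adicCompletion K) - b' v) = b v := by
      change b v - 0 = b v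
      rw [sub_zero]
    rw [e]
    refine (hb v).trans_lt ?_
    rw [Finsupp.onFinset_apply, if_pos (Finset.mem_coe.1 hv)]
    exact hN v
  have hzV := hIt hzt
  have hzb : (show FiniteAdeleRing (𝓞 K) K from
      RestrictedProduct.structureMap (HeightOneSpectrum.adicCompletion (R := 𝓞 K) K)
        (fun v : HeightOneSpectrum (𝓞 K) => (v.adicCompletionIntegers K : Set (v.adicCompletion K)))
        Filter.cofinite z) = b :=
    FiniteAdeleRing.ext K fun v => rfl
  rw [← hzb]
  exact hzV

/-- **`K + K_{σ₀}` is dense in `𝔸_K`** (strong approximation leaving the infinite place `σ₀`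
free, `AdeleRing.strongApproximation_infinitePlace`): every neighbourhood of an adele `x` contains
an adele `c + (a, 0)` with `c ∈ K` principal and `a ∈ K_∞` vanishing at all infinite places
`≠ σ₀`. [cite: CasselsFrohlichANT1967, Ch. II §15 Theorem (strong approximation)] -/
theorem AdeleRing.exists_principal_add_single_mem_nhds (σ₀ : InfinitePlace K) (x : AdeleRing (𝓞 K) K)
    {W : Set (AdeleRing (𝓞 K) K)} (hW : W ∈ 𝓝 x) :
    ∃ c : K, ∃ a : InfiniteAdeleRing K, (∀ σ : InfinitePlace K, σ ≠ σ₀ → a σ = 0) ∧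
      algebraMap K (AdeleRing (𝓞 K) K) c + infiniteAdeleInl K a ∈ W := by
  classical
  -- a product neighbourhood of `0` inside `{z | x - z ∈ W}`
  have hW0 : {z : AdeleRing (𝓞 K) K | x - z ∈ W} ∈ 𝓝 (0 : AdeleRing (𝓞 K) K) := by
    have hc : Continuous fun z : AdeleRing (𝓞 K) K => x - z := continuous_const.sub continuous_id
    refine hc.continuousAt.preimage_mem_nhds ?_
    have e : x - (0 : AdeleRing (𝓞 K) K) = x := sub_zero x
    rw [e]; exact hW
  have hW0' : {z : AdeleRing (𝓞 K) K | x - z ∈ W} ∈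
      𝓝 ((0 : InfiniteAdeleRing K), (0 : FiniteAdeleRing (𝓞 K) K)) := hW0
  obtain ⟨V₁, hV₁, V₂, hV₂, hprod⟩ := mem_nhds_prod_iff.1 hW0'
  obtain ⟨ε, hε, hεV⟩ := InfiniteAdeleRing.exists_forall_norm_lt_subset K hV₁
  obtain ⟨m, hmV⟩ := FiniteAdeleRing.exists_finsupp_forall_valued_le_subset K hV₂
  obtain ⟨c, hcinf, hcfin⟩ := AdeleRing.strongApproximation_infinitePlace K σ₀ x m hε
  set a : InfiniteAdeleRing K := fun σ =>
    if σ = σ₀ then (x - algebraMap K (AdeleRing (𝓞 K) K) c).1 σ else 0 with ha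
  refine ⟨c, a, fun σ hσ => by rw [ha]; exact if_neg hσ, ?_⟩
  have e1 : ∀ σ, (x - (algebraMap K (AdeleRing (𝓞 K) K) c + infiniteAdeleInl K a)).1 σ =
      (x - algebraMap K (AdeleRing (𝓞 K) K) c).1 σ - a σ := fun σ => by
    change x.1 σ - ((algebraMap K (AdeleRing (𝓞 K) K) c).1 σ + a σ) =
      x.1 σ - (algebraMap K (AdeleRing (𝓞 K) K) c).1 σ - a σ
    ring
  have e2 : (x - (algebraMap K (AdeleRing (𝓞 K) K) c + infiniteAdeleInl K a)).2 =
      (x - algebraMap K (AdeleRing (𝓞 K) K) c).2 := by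
    change x.2 - ((algebraMap K (AdeleRing (𝓞 K) K) c).2 + 0) = x.2 - (algebraMap K (AdeleRing (𝓞 K) K) c).2
    rw [add_zero]
  have hmem : x - (algebraMap K (AdeleRing (𝓞 K) K) c + infiniteAdeleInl K a) ∈
      {z : AdeleRing (𝓞 K) K | x - z ∈ W} := by
    refine hprod (Set.mem_prod.2 ⟨hεV fun σ => ?_, hmV fun v => ?_⟩)
    · rw [e1]
      by_cases hσ : σ = σ₀
      · have haσ : a σ = (x - algebraMap K (AdeleRing (𝓞 K) K) c).1 σ := by rw [ha]; exact if_pos hσ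
        rw [haσ, sub_self, norm_zero]
        exact hε
      · have haσ : a σ = 0 := by rw [ha]; exact if_neg hσ
        rw [haσ, sub_zero]
        exact hcinf σ hσ
    · rw [e2]
      exact hcfin v
  have e : x - (x - (algebraMap K (AdeleRing (𝓞 K) K) c + infiniteAdeleInl K a)) =
      algebraMap K (AdeleRing (𝓞 K) K) c + infiniteAdeleInl K a := sub_sub_cancel _ _
  rw [← e]
  exact hmem

variable {K} {n k : ℕ}

/-- **`𝔫_k(K) + archBlock (directions supported at σ₀)` is dense in `𝔫_k(𝔸_K)`**: every
neighbourhood of a block-nilpotent adelic matrix contains `r + archBlock b` with `r` rational and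
`b` an archimedean block direction supported at `σ₀` (entrywise
`AdeleRing.exists_principal_add_single_mem_nhds`). [folklore] -/
theorem exists_rational_add_archBlock_mem_nhds (σ₀ : InfinitePlace K)
    (X : blockNilpotent n k (AdeleRing (𝓞 K) K)) {U : Set (blockNilpotent n k (AdeleRing (𝓞 K) K))}
    (hU : U ∈ 𝓝 X) :
    ∃ r : rationalBlock n k K, ∃ b : ArchBlockSpace n k K, (∀ p, b p ∈ supportedAt K σ₀) ∧
      (r : blockNilpotent n k (AdeleRing (𝓞 K) K)) + archBlock n k K b ∈ U := by
  classical
  obtain ⟨O, hO, hOU⟩ := (mem_nhds_subtype _ X U).1 hU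
  -- a box inside `O`
  obtain ⟨W, hW, hWO⟩ : ∃ W : Fin n → Fin n → Set (AdeleRing (𝓞 K) K),
      (∀ i j, W i j ∈ 𝓝 ((X : Matrix (Fin n) (Fin n) (AdeleRing (𝓞 K) K)) i j)) ∧
        {Z : Matrix (Fin n) (Fin n) (AdeleRing (𝓞 K) K) | ∀ i j, Z i j ∈ W i j} ⊆ O := by
    have hO' : O ∈ Filter.pi fun i : Fin n => 𝓝 ((X : Matrix (Fin n) (Fin n) (AdeleRing (𝓞 K) K)) i) := by
      have e : 𝓝 (X : Matrix (Fin n) (Fin n) (AdeleRing (𝓞 K) K)) =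
          Filter.pi fun i : Fin n => 𝓝 ((X : Matrix (Fin n) (Fin n) (AdeleRing (𝓞 K) K)) i) := nhds_pi
      rw [← e]; exact hO
    obtain ⟨I, t, ht, hIt⟩ := Filter.mem_pi'.1 hO'
    have hrow : ∀ i : Fin n, ∃ s : Fin n → Set (AdeleRing (𝓞 K) K),
        (∀ j, s j ∈ 𝓝 ((X : Matrix (Fin n) (Fin n) (AdeleRing (𝓞 K) K)) i j)) ∧
          (∀ f : Fin n → AdeleRing (𝓞 K) K, (∀ j, f j ∈ s j) → f ∈ t i) := fun i => by
      have hti : t i ∈ Filter.pi fun j : Fin n => 𝓝 ((X : Matrix (Fin n) (Fin n) (AdeleRing (𝓞 K) K)) i j) := by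
        have e : 𝓝 ((X : Matrix (Fin n) (Fin n) (AdeleRing (𝓞 K) K)) i) =
            Filter.pi fun j : Fin n => 𝓝 ((X : Matrix (Fin n) (Fin n) (AdeleRing (𝓞 K) K)) i j) := nhds_pi
        rw [← e]; exact ht i
      obtain ⟨J, s, hs, hJs⟩ := Filter.mem_pi'.1 hti
      exact ⟨s, hs, fun f hf => hJs fun j _ => hf j⟩
    choose s hs hst using hrow
    exact ⟨s, hs, fun Z hZ => hIt fun i _ => hst i (Z i) fun j => hZ i j⟩
  -- approximate each block entry
  have hent : ∀ p : BlockPos n k, ∃ c : K, ∃ a : InfiniteAdeleRing K,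
      (∀ σ : InfinitePlace K, σ ≠ σ₀ → a σ = 0) ∧
        algebraMap K (AdeleRing (𝓞 K) K) c + infiniteAdeleInl K a ∈ W p.1.1 p.1.2 :=
    fun p => AdeleRing.exists_principal_add_single_mem_nhds K σ₀ _ (hW p.1.1 p.1.2)
  choose c a ha hmem using hent
  -- the rational part
  set R : Matrix (Fin n) (Fin n) (AdeleRing (𝓞 K) K) := Matrix.of fun i j =>
    if h : (i : ℕ) < k ∧ k ≤ (j : ℕ) then algebraMap K (AdeleRing (𝓞 K) K) (c ⟨(i, j), h⟩) else 0 with hR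
  have hRblock : R ∈ blockNilpotent n k (AdeleRing (𝓞 K) K) := by
    intro i j hij
    by_contra hb
    exact hij (by rw [hR, Matrix.of_apply, dif_neg hb])
  have hRrat : (⟨R, hRblock⟩ : blockNilpotent n k (AdeleRing (𝓞 K) K)) ∈ rationalBlock n k K := by
    intro i j
    change R i j ∈ _
    rw [hR, Matrix.of_apply]
    by_cases h : (i : ℕ) < k ∧ k ≤ (j : ℕ)
    · rw [dif_pos h]; exact ⟨_, rfl⟩
    · rw [dif_neg h]; exact ⟨0, map_zero _⟩
  -- the archimedean direction
  set b : ArchBlockSpace n k K := fun p => InfiniteAdeleRing.ringEquiv_mixedSpace K (a p) with hb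
  refine ⟨⟨⟨R, hRblock⟩, hRrat⟩, b, fun p => ringEquiv_mixedSpace_mem_supportedAt (ha p), hOU (hWO fun i j => ?_)⟩
  change R i j + ((archBlock n k K b : blockNilpotent n k (AdeleRing (𝓞 K) K)) :
    Matrix (Fin n) (Fin n) (AdeleRing (𝓞 K) K)) i j ∈ W i j
  have harch : ((archBlock n k K b : blockNilpotent n k (AdeleRing (𝓞 K) K)) :
      Matrix (Fin n) (Fin n) (AdeleRing (𝓞 K) K)) i j =
        infiniteAdeleInl K ((InfiniteAdeleRing.ringEquiv_mixedSpace K).symm (blockMatrixOf n k K b i j)) :=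
    Prod.ext (fst_archBlock_apply b i j) (snd_archBlock_apply b i j)
  rw [harch, hR, Matrix.of_apply]
  by_cases h : (i : ℕ) < k ∧ k ≤ (j : ℕ)
  · rw [dif_pos h, blockMatrixOf_apply_of_mem b h]
    change algebraMap K (AdeleRing (𝓞 K) K) (c ⟨(i, j), h⟩) +
      infiniteAdeleInl K ((InfiniteAdeleRing.ringEquiv_mixedSpace K).symm
        (InfiniteAdeleRing.ringEquiv_mixedSpace K (a ⟨(i, j), h⟩))) ∈ W i j
    rw [RingEquiv.symm_apply_apply]
    exact hmem ⟨(i, j), h⟩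
  · rw [dif_neg h, blockMatrixOf_apply_of_not b h, map_zero, map_zero, add_zero]
    have h0 : (X : Matrix (Fin n) (Fin n) (AdeleRing (𝓞 K) K)) i j = 0 :=
      apply_eq_zero_of_mem_blockNilpotent X.2 h
    rw [← h0]
    exact mem_of_mem_nhds (hW i j)

end Density

/-! ### 4. The vanishing theorem -/

section Main

variable {n : ℕ} {K : Type} [Field K] [NumberField K]

/-- **The constant-term integrand of an annihilated cusp form is constant**: for `φ` continuous,
left `GL_n(K)`-invariant, smooth in the archimedean variable and killed by the Lie derivatives
along the square-zero `Y ∈ 𝔤𝔩_n(K_∞)` supported at `σ₀`, `φ ((1 + X) g) = φ g` for every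
`X ∈ 𝔫_k(𝔸_K)` (invariance under the dense subgroup `𝔫_k(K) + archBlock 𝔫_k(K_{σ₀})` and
continuity). [folklore] -/
theorem apply_unipotentOfBlock_mul_eq_of_forall_lieDeriv_eq_zero {k : ℕ} (σ₀ : InfinitePlace K)
    {φ : GL (Fin n) (AdeleRing (𝓞 K) K) → ℂ} (hφc : Continuous φ)
    (hφl : IsLeftInvariant (AdelicGroupData.gl n K) φ)
    (hφs : IsArchSmooth (glArch n K) φ)
    (h : ∀ Y : Matrix (Fin n) (Fin n) (mixedSpace K), Y * Y = 0 → (∀ i j, Y i j ∈ supportedAt K σ₀) →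
      lieDeriv (glArch n K) (lieOf Y) φ = 0)
    (X : blockNilpotent n k (AdeleRing (𝓞 K) K)) (g : GL (Fin n) (AdeleRing (𝓞 K) K)) :
    φ (unipotentOfBlock n k (AdeleRing (𝓞 K) K) (Multiplicative.ofAdd X) * g) = φ g := by
  set F : blockNilpotent n k (AdeleRing (𝓞 K) K) → ℂ := fun X =>
    φ (unipotentOfBlock n k (AdeleRing (𝓞 K) K) (Multiplicative.ofAdd X) * g) with hF
  have hFc : Continuous F :=
    hφc.comp ((continuous_unipotentOfBlock_ofAdd'.comp continuous_id).mul continuous_const)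
  -- the closed set where `F = φ g` contains the dense set of `r + archBlock b`
  have hC : IsClosed {X : blockNilpotent n k (AdeleRing (𝓞 K) K) | F X = φ g} :=
    isClosed_eq hFc continuous_const
  set D : Set (blockNilpotent n k (AdeleRing (𝓞 K) K)) :=
    {X | ∃ r : rationalBlock n k K, ∃ b : ArchBlockSpace n k K, (∀ p, b p ∈ supportedAt K σ₀) ∧
        X = (r : blockNilpotent n k (AdeleRing (𝓞 K) K)) + archBlock n k K b} with hD
  have hDC : D ⊆ {X | F X = φ g} := by
    rintro _ ⟨r, b, hb, rfl⟩
    change φ (unipotentOfBlock n k (AdeleRing (𝓞 K) K)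
      (Multiplicative.ofAdd ((r : blockNilpotent n k (AdeleRing (𝓞 K) K)) + archBlock n k K b)) * g) = φ g
    have h1 : (r : blockNilpotent n k (AdeleRing (𝓞 K) K)) + archBlock n k K b = r +ᵥ archBlock n k K b := rfl
    rw [h1, hφl.apply_glUnipotent_vadd_mul r (archBlock n k K b) g, ← add_zero (archBlock n k K b),
      apply_unipotentOfBlock_archBlock_add_mul hφs h hb 0 g, ofAdd_zero, map_one, one_mul]
  have hXD : X ∈ closure D := by
    rw [mem_closure_iff_nhds]
    intro U hU
    obtain ⟨r, b, hb, hmem⟩ := exists_rational_add_archBlock_mem_nhds σ₀ X hU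
    exact ⟨_, hmem, r, b, hb, rfl⟩
  exact closure_minimal hDC hC hXD

variable {hcpt : isCompact_glFiniteIntegralLevel n K}

/-- **A cusp form on `GL_n`, `n ≥ 2`, annihilated by the square-zero directions at one
archimedean place vanishes.**  If `φ ∈ 𝒜₀` and `Y φ = 0` for every `Y ∈ 𝔤𝔩_n(K_∞)` with
`Y² = 0` supported at the infinite place `σ₀`, then `φ = 0`: the constant-term integrand
`X ↦ φ ((1 + X) g)` along `P_1` is constant (`apply_unipotentOfBlock_mul_eq_of_forall_lieDeriv_eq_zero`),
so the cusp condition over Tate's block fundamental domain `𝓕` (of positive finite Haar measure)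
gives `ν(𝓕) φ(g) = 0`. [cite: BorelJacquet1979, §4.4]
[cite: CasselsFrohlichANT1967, Ch. II §15 Theorem (strong approximation)] -/
theorem eq_zero_of_mem_cuspFormsGL_of_forall_lieDeriv_eq_zero (hn : 2 ≤ n) (σ₀ : InfinitePlace K)
    {φ : (AdelicGroupData.gl n K).Adelic → ℂ} (hφ : φ ∈ cuspFormsGL n K hcpt)
    (h : ∀ Y : Matrix (Fin n) (Fin n) (mixedSpace K), Y * Y = 0 → (∀ i j, Y i j ∈ supportedAt K σ₀) →
      lieDeriv (AutomorphyDatum.gl n K hcpt).ofArch (lieOf Y) φ = 0) :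
    φ = 0 := by
  have hφA : φ ∈ automorphicForms (AutomorphyDatum.gl n K hcpt) := cuspFormsGL_le_automorphicForms n K hcpt hφ
  have hφc : Continuous φ := continuous_of_mem_automorphicForms_gl hφA
  have hφl : IsLeftInvariant (AdelicGroupData.gl n K) φ := isLeftInvariant_of_mem_automorphicForms hφA
  have hφs : IsArchSmooth (glArch n K) φ := automorphicForms_le_archSmooth _ hφA
  have h' : ∀ Y : Matrix (Fin n) (Fin n) (mixedSpace K), Y * Y = 0 → (∀ i j, Y i j ∈ supportedAt K σ₀) →
      lieDeriv (glArch n K) (lieOf Y) φ = 0 := h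
  funext g
  have hconst : ∀ X : blockNilpotent n 1 (AdeleRing (𝓞 K) K),
      φ (glUnipotent n 1 K (Multiplicative.ofAdd X) * g) = φ g :=
    fun X => apply_unipotentOfBlock_mul_eq_of_forall_lieDeriv_eq_zero σ₀ hφc hφl hφs h' X g
  have hcusp := (cuspConditionGL_of_mem_cuspFormsGL hφ (k := 1) one_pos (by omega))
    (blockHaar n 1 K) (scaledBlockFundamentalDomain n 1 K (1 : K))
    (isAddFundamentalDomain_scaledBlockFundamentalDomain one_ne_zero _) g
  have hint := hcusp.2
  simp_rw [hconst] at hint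
  rw [setIntegral_const] at hint
  have hne : (blockHaar n 1 K) (scaledBlockFundamentalDomain n 1 K (1 : K)) ≠ 0 :=
    measure_scaledBlockFundamentalDomain_ne_zero one_ne_zero _
  have hlt : (blockHaar n 1 K) (scaledBlockFundamentalDomain n 1 K (1 : K)) < ⊤ :=
    measure_scaledBlockFundamentalDomain_lt_top (1 : K) _
  have hreal : ((blockHaar n 1 K) (scaledBlockFundamentalDomain n 1 K (1 : K))).toReal ≠ 0 :=
    (ENNReal.toReal_pos hne hlt.ne).ne'
  rw [measureReal_def, smul_eq_zero] at hint
  exact hint.resolve_left hreal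

/-- **Corollary (all square-zero directions).**  A cusp form on `GL_n`, `n ≥ 2`, with `Y φ = 0`
for every square-zero `Y ∈ 𝔤𝔩_n(K_∞)` vanishes. [cite: BorelJacquet1979, §4.4] -/
theorem eq_zero_of_mem_cuspFormsGL_of_forall_sq_eq_zero (hn : 2 ≤ n)
    {φ : (AdelicGroupData.gl n K).Adelic → ℂ} (hφ : φ ∈ cuspFormsGL n K hcpt)
    (h : ∀ Y : Matrix (Fin n) (Fin n) (mixedSpace K), Y * Y = 0 →
      lieDeriv (AutomorphyDatum.gl n K hcpt).ofArch (lieOf Y) φ = 0) :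
    φ = 0 :=
  eq_zero_of_mem_cuspFormsGL_of_forall_lieDeriv_eq_zero hn (Classical.arbitrary (InfinitePlace K)) hφ
    fun Y hY _ => h Y hY

omit [NumberField K] in
/-- A matrix over `K_∞` supported at a COMPLEX place `w` is the image of its `w`-component under
`complexPlaceLie`. [folklore] -/
theorem eq_complexPlaceLie_of_forall_mem_supportedAt (w : {w : InfinitePlace K // w.IsComplex})
    {Y : Matrix (Fin n) (Fin n) (mixedSpace K)} (hY : ∀ i j, Y i j ∈ supportedAt K w.1) :
    Y = complexPlaceLie n w (Y.map (mixedSpaceEvalComplex K w)) := by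
  ext i j : 1
  rw [complexPlaceLie_apply, Matrix.map_apply, mixedSpaceEvalComplex_apply]
  obtain ⟨h1, h2⟩ := hY i j
  refine Prod.ext (funext fun v => ?_) (funext fun v => ?_)
  · have hv : v.1 ≠ w.1 := fun e => (not_isReal_iff_isComplex.2 w.2) (e ▸ v.2)
    rw [h1 v hv]; rfl
  · by_cases hv : v = w
    · subst hv; simp
    · have hv' : v.1 ≠ w.1 := fun e => hv (Subtype.ext e)
      rw [h2 v hv']
      change (0 : ℂ) = Pi.single (M := fun _ => ℂ) w ((Y i j).2 w) v
      rw [Pi.single_eq_of_ne hv]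

omit [NumberField K] in
/-- A matrix over `K_∞` supported at a REAL place `w` is the image of its `w`-component under
`realPlaceLie`. [folklore] -/
theorem eq_realPlaceLie_of_forall_mem_supportedAt (w : {w : InfinitePlace K // w.IsReal})
    {Y : Matrix (Fin n) (Fin n) (mixedSpace K)} (hY : ∀ i j, Y i j ∈ supportedAt K w.1) :
    Y = realPlaceLie n w (Y.map (mixedSpaceEvalReal K w)) := by
  ext i j : 1
  rw [realPlaceLie_apply, Matrix.map_apply, mixedSpaceEvalReal_apply]
  obtain ⟨h1, h2⟩ := hY i j
  refine Prod.ext (funext fun v => ?_) (funext fun v => ?_)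
  · by_cases hv : v = w
    · subst hv; simp
    · have hv' : v.1 ≠ w.1 := fun e => hv (Subtype.ext e)
      rw [h1 v hv']
      change (0 : ℝ) = Pi.single (M := fun _ => ℝ) w ((Y i j).1 w) v
      rw [Pi.single_eq_of_ne hv]
  · have hv : v.1 ≠ w.1 := fun e => (not_isReal_iff_isComplex.2 v.2) (e ▸ w.2)
    rw [h2 v hv]; rfl

/-- **Corollary (one complex place).**  A cusp form on `GL_n`, `n ≥ 2`, with `φ_w(Z) φ = 0` for
every square-zero `Z ∈ M_n(ℂ)` at a complex place `w` (`φ_w = complexPlaceLie n w`; the element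
`lieOf (complexPlaceLie n w Z)` is `ComplexPlace.placeLie n w Z` of `ArchComplexPlaceCasimir`
definitionally) vanishes.  With `GL2CArchOps.rho_apply_eq_zero_of_killed` this is the hypothesis
"no vector is killed by the six operators" of `GL2CUnitaryKTypes.exists_isHW_two_mul` for the forms
of a cuspidal representation of `GL₂` [cite: Harder1987, §3.1]. [cite: BorelJacquet1979, §4.4] -/
theorem eq_zero_of_mem_cuspFormsGL_of_forall_lieDeriv_complexPlace (hn : 2 ≤ n)
    (w : {w : InfinitePlace K // w.IsComplex})
    {φ : (AdelicGroupData.gl n K).Adelic → ℂ} (hφ : φ ∈ cuspFormsGL n K hcpt)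
    (h : ∀ Z : Matrix (Fin n) (Fin n) ℂ, Z * Z = 0 →
      lieDeriv (AutomorphyDatum.gl n K hcpt).ofArch (lieOf (complexPlaceLie n w Z)) φ = 0) :
    φ = 0 := by
  refine eq_zero_of_mem_cuspFormsGL_of_forall_lieDeriv_eq_zero hn w.1 hφ fun Y hY hYσ => ?_
  have e := eq_complexPlaceLie_of_forall_mem_supportedAt w hYσ
  have hZ : Y.map (mixedSpaceEvalComplex K w) * Y.map (mixedSpaceEvalComplex K w) = 0 := by
    rw [← Matrix.map_mul, hY, Matrix.map_zero _ (map_zero _)]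
  have e' : lieOf Y = lieOf (complexPlaceLie n w (Y.map (mixedSpaceEvalComplex K w))) := by
    rw [← e]
  rw [e']
  exact h _ hZ

/-- **Corollary (one real place).**  A cusp form on `GL_n`, `n ≥ 2`, with `φ_w(Z) φ = 0` for every
square-zero `Z ∈ M_n(ℝ)` at a real place `w` (`φ_w = realPlaceLie n w`) vanishes.
[cite: BorelJacquet1979, §4.4] -/
theorem eq_zero_of_mem_cuspFormsGL_of_forall_lieDeriv_realPlace (hn : 2 ≤ n)
    (w : {w : InfinitePlace K // w.IsReal})
    {φ : (AdelicGroupData.gl n K).Adelic → ℂ} (hφ : φ ∈ cuspFormsGL n K hcpt)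
    (h : ∀ Z : Matrix (Fin n) (Fin n) ℝ, Z * Z = 0 →
      lieDeriv (AutomorphyDatum.gl n K hcpt).ofArch (lieOf (realPlaceLie n w Z)) φ = 0) :
    φ = 0 := by
  refine eq_zero_of_mem_cuspFormsGL_of_forall_lieDeriv_eq_zero hn w.1 hφ fun Y hY hYσ => ?_
  have e := eq_realPlaceLie_of_forall_mem_supportedAt w hYσ
  have hZ : Y.map (mixedSpaceEvalReal K w) * Y.map (mixedSpaceEvalReal K w) = 0 := by
    rw [← Matrix.map_mul, hY, Matrix.map_zero _ (map_zero _)]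
  have e' : lieOf Y = lieOf (realPlaceLie n w (Y.map (mixedSpaceEvalReal K w))) := by
    rw [← e]
  rw [e']
  exact h _ hZ

/-- **Cuspidal automorphic representations of `GL_n`, `n ≥ 2`, have no vector killed by the
square-zero directions at a complex place**: for `π` cuspidal and `φ ∈ W`, if `φ_w(Z) φ = 0` for all
`Z ∈ M_n(ℂ)` with `Z² = 0` then `φ = 0` — the hypothesis `hnoinv` of
`GL2CUnitaryKTypes.exists_isHW_two_mul` for `W`. [cite: Harder1987, §3.1] -/
theorem CuspidalAutomorphicRepData.eq_zero_of_forall_lieDeriv_complexPlace (hn : 2 ≤ n)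
    (π : CuspidalAutomorphicRepData n K hcpt) (w : {w : InfinitePlace K // w.IsComplex})
    {φ : (AdelicGroupData.gl n K).Adelic → ℂ} (hφ : φ ∈ π.1.W)
    (h : ∀ Z : Matrix (Fin n) (Fin n) ℂ, Z * Z = 0 →
      lieDeriv (AutomorphyDatum.gl n K hcpt).ofArch (lieOf (complexPlaceLie n w Z)) φ = 0) :
    φ = 0 :=
  eq_zero_of_mem_cuspFormsGL_of_forall_lieDeriv_complexPlace hn w (π.le_cuspFormsGL hφ) h

omit [NumberField K] in
/-- A square-zero complex matrix has trace zero (it is nilpotent). [folklore] -/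
theorem Matrix.trace_eq_zero_of_mul_self_eq_zero {m : Type*} [Fintype m] [DecidableEq m]
    {Z : Matrix m m ℂ} (hZ : Z * Z = 0) : Z.trace = 0 :=
  (Matrix.isNilpotent_trace_of_isNilpotent ⟨2, by rw [pow_two, hZ]⟩).eq_zero

/-- **Corollary (one complex place, trace-zero form).**  A cusp form on `GL_n`, `n ≥ 2`, with
`φ_w(Z) φ = 0` for every TRACE-ZERO `Z ∈ M_n(ℂ)` at a complex place `w` vanishes (square-zero
matrices have trace zero) — the form produced by `GL2CArchOps.rho_apply_eq_zero_of_killed`.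
[cite: Harder1987, §3.1] [cite: BorelJacquet1979, §4.4] -/
theorem eq_zero_of_mem_cuspFormsGL_of_forall_lieDeriv_complexPlace_trace (hn : 2 ≤ n)
    (w : {w : InfinitePlace K // w.IsComplex})
    {φ : (AdelicGroupData.gl n K).Adelic → ℂ} (hφ : φ ∈ cuspFormsGL n K hcpt)
    (h : ∀ Z : Matrix (Fin n) (Fin n) ℂ, Z.trace = 0 →
      lieDeriv (AutomorphyDatum.gl n K hcpt).ofArch (lieOf (complexPlaceLie n w Z)) φ = 0) :
    φ = 0 :=
  eq_zero_of_mem_cuspFormsGL_of_forall_lieDeriv_complexPlace hn w hφ fun Z hZ =>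
    h Z (Matrix.trace_eq_zero_of_mul_self_eq_zero hZ)

/-- **Cuspidal `π` of `GL_n`, `n ≥ 2`: a form killed by the Lie derivatives along the trace-zero
matrices at a complex place is zero** (`φ ∈ W`, `φ_w(Z) φ = 0` for all `Z` with `tr Z = 0`, then
`φ = 0`) — with `GL2CCuspFormLowestKType.lieDeriv_placeLie_eq_zero_of_killed` this discharges the
hypothesis `hnoinv` of `GL2CCuspFormLowestKType.exists_lowestKType_of_noinv` /
`GL2CUnitaryKTypes.exists_isHW_two_mul` (`ComplexPlace.placeLie n w Z` is
`lieOf (complexPlaceLie n w Z)` definitionally). [cite: Harder1987, §3.1] -/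
theorem CuspidalAutomorphicRepData.eq_zero_of_forall_lieDeriv_complexPlace_trace (hn : 2 ≤ n)
    (π : CuspidalAutomorphicRepData n K hcpt) (w : {w : InfinitePlace K // w.IsComplex})
    {φ : (AdelicGroupData.gl n K).Adelic → ℂ} (hφ : φ ∈ π.1.W)
    (h : ∀ Z : Matrix (Fin n) (Fin n) ℂ, Z.trace = 0 →
      lieDeriv (AutomorphyDatum.gl n K hcpt).ofArch (lieOf (complexPlaceLie n w Z)) φ = 0) :
    φ = 0 :=
  eq_zero_of_mem_cuspFormsGL_of_forall_lieDeriv_complexPlace_trace hn w (π.le_cuspFormsGL hφ) h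

end Main

end Literature.NumberTheory.Automorphic

end
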